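import Summits.BirchSwinnertonDyer.BirchSwinnertonDyer.Theorems.ManinLocalTwoThreeParabolicElements
import Summits.BirchSwinnertonDyer.BirchSwinnertonDyer.Theorems.ManinLocalTwoThreeParabolicHeckePerm
import HarnessLib

/-!
# PARABOLICITY, part 2/3: `(T_r u)(π_x) = r · u(π_{ρ_r x}) + u(π_{ρ_r⁻¹ x})` for a `Γ₀(M)`-homomorphism `u`

Summit `BirchSwinnertonDyer`, route `ManinLocalTwoThree` (cell bsd-f2-manin), cruxes C2 `ManinOddAtFour` (stmt-BirchSwinnertonDyer-22967)
/ C3 `ManinPrimeToThreeAtNine` (stmt-BirchSwinnertonDyer-22968); hypothesis PARABOLICITY of p3's assembly of E-es-35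
(MEMO-es §22.2 (0), ref1 §R43 N4), continued from `…ParabolicElements.lean`.  The restriction of `T_r = heckeU 0 M K`
(`r` prime, `r ∤ M`) to cusp stabilisers, WITHOUT classifying the cusps of `Γ₀(M)`: for `x = g∞`, `π = g T^w g⁻¹ ∈ Γ₀(M)`,
* (level lowering = p2's `heckePerm_eq_of_candidate`: an integer factorisation `γ' β_k = βᵢ π` IS the level-`M` datum;)
* `heckeData_conj_T_zpow_none/some` — the data of `π` are the level-`1` data of `g` (p2's `heckeIdxPre`) twisted by
  `j ↦ j + w` on `ℤ/r`: one fixed index (that of `ρ_r x`) and one `r`-cycle (the class of `ρ_r⁻¹ x`);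
* `heckeU_apply_conj_T_zpow` (the cycle telescopes, total carry `w`) and **`heckeU_cuspValue`**: with the normalised
  generators `π_y = g_y T^{w_y} g_y⁻¹` of part 1, `(T_r u)(π_x) = r · u(π_{ρ_r x}) + u(π_{ρ_r⁻¹ x})` — the degree-`1`
  companion of p2's `cuspFunHecke_eq_heckeNbr`, weights of `ρ_r^{±1}` exchanged.
No new definitions; nothing about BSD or Manin's conjecture is proved here.  References: G. Shimura (1971) §1.6, §8.3
(8.3.2); Diamond–Shurman GTM 228 §5.2; HOME/MEMO-es.md §22.2 (0), §22.3.
-/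

set_option autoImplicit false
set_option linter.dupNamespace false

open scoped MatrixGroups

open CongruenceSubgroup Matrix.SpecialLinearGroup ModularGroup Literature.NumberTheory.EllipticCurves.ModularForms
  Literature.NumberTheory.EllipticCurves.ModularForms.HidaCohomology

namespace Summit.BirchSwinnertonDyer.BirchSwinnertonDyer.Theorems.ManinLocalTwoThree

/-! ### The carry of `j + w` past `r` -/

section Carry

variable (r : ℕ) [NeZero r]

/-- The carry `q` of `j + w` past `r`: `q r = j + w − (j + w mod r)`. [folklore] -/
theorem carry_mul (j : ZMod r) (w : ℤ) :
    ((j.val : ℤ) + w - ((j + (w : ZMod r)).val : ℤ)) / r * r = (j.val : ℤ) + w - ((j + (w : ZMod r)).val : ℤ) := by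
  apply Int.ediv_mul_cancel
  rw [← ZMod.intCast_zmod_eq_zero_iff_dvd]
  push_cast
  rw [ZMod.natCast_zmod_val, ZMod.natCast_zmod_val]
  ring

end Carry

/-! ### Telescoping along a cycle, and reindexing `ZMod r` along multiples of a unit -/

section Telescope

variable {M : ℕ} {K : Type*} [CommRing K] {u : Gamma0 M → Fin 1 → K}

/-- `u(1) = 0` for an additive `u`. [folklore] -/
theorem cocycle_zero_one (hu : u ∈ cocycles 0 M K) : u 1 = 0 := by
  have h := cocycle_zero_mul hu 1 1
  rw [mul_one] at h
  exact left_eq_add.mp h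

/-- **Telescoping**: `Σ_{k<n} u(F_k T^{q_k} F_{k+1}⁻¹) = u(F_0 T^{Σ q_k} F_n⁻¹)` for an additive `u` on `Γ₀(M)`
(all factors in `Γ₀(M)`). [folklore] -/
theorem cocycle_zero_telescope (hu : u ∈ cocycles 0 M K) (F : ℕ → SL(2, ℤ)) (q : ℕ → ℤ)
    (hE : ∀ k, F k * T ^ (q k) * (F (k + 1))⁻¹ ∈ Gamma0 M) (n : ℕ) :
    ∃ hmem : F 0 * T ^ (∑ k ∈ Finset.range n, q k) * (F n)⁻¹ ∈ Gamma0 M,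
      u ⟨_, hmem⟩ = ∑ k ∈ Finset.range n, u ⟨_, hE k⟩ := by
  induction n with
  | zero =>
    have h1 : F 0 * T ^ (∑ k ∈ Finset.range 0, q k) * (F 0)⁻¹ = 1 := by simp
    have hmem0 : F 0 * T ^ (∑ k ∈ Finset.range 0, q k) * (F 0)⁻¹ ∈ Gamma0 M := by rw [h1]; exact one_mem _
    refine ⟨hmem0, ?_⟩
    have e1 : (⟨_, hmem0⟩ : Gamma0 M) = 1 := Subtype.ext h1
    rw [e1, cocycle_zero_one hu, Finset.sum_range_zero]
  | succ n ih =>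
    obtain ⟨hmem, hval⟩ := ih
    have hprod : F 0 * T ^ (∑ k ∈ Finset.range (n + 1), q k) * (F (n + 1))⁻¹ =
        (F 0 * T ^ (∑ k ∈ Finset.range n, q k) * (F n)⁻¹) * (F n * T ^ (q n) * (F (n + 1))⁻¹) := by
      rw [Finset.sum_range_succ, zpow_add]
      group
    have hmem' : F 0 * T ^ (∑ k ∈ Finset.range (n + 1), q k) * (F (n + 1))⁻¹ ∈ Gamma0 M := by
      rw [hprod]; exact mul_mem hmem (hE n)
    refine ⟨hmem', ?_⟩
    have e1 : (⟨_, hmem'⟩ : Gamma0 M) = ⟨_, hmem⟩ * ⟨_, hE n⟩ := Subtype.ext hprod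
    rw [e1, cocycle_zero_mul hu, hval, Finset.sum_range_succ]

/-- **Reindexing `ZMod r` along the multiples of a unit**: `Σ_{j} f(j) = Σ_{k<r} f(k · w)` for `w ∈ (ℤ/r)ˣ`. [folklore] -/
theorem sum_zmod_eq_sum_range_mul {r : ℕ} [NeZero r] {A : Type*} [AddCommMonoid A] (f : ZMod r → A) (w : (ZMod r)ˣ) :
    ∑ j : ZMod r, f j = ∑ k ∈ Finset.range r, f ((k : ZMod r) * (w : ZMod r)) := by
  rw [← Fin.sum_univ_eq_sum_range (fun k ↦ f ((k : ZMod r) * (w : ZMod r))) r]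
  obtain ⟨n, hn⟩ : ∃ n, r = n + 1 := Nat.exists_eq_add_one.mpr (Nat.pos_of_ne_zero (NeZero.ne r))
  subst hn
  rw [← Equiv.sum_comp (Units.mulRight w) f]
  refine Fintype.sum_congr _ _ fun k ↦ ?_
  change f (k * (w : ZMod (n + 1))) = f (((ZMod.val k : ℕ) : ZMod (n + 1)) * (w : ZMod (n + 1)))
  rw [ZMod.natCast_zmod_val k]

end Telescope

/-! ### The level-`M` Hecke data of `π = g T^w g⁻¹` from the level-`1` data of `g` -/

section HeckeData

variable {M r : ℕ} (hr : r.Prime)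

/-- The level-`1` datum at the index `σ_g⁻¹(o)`: `g'_{σ⁻¹ o} β_o = β_{σ⁻¹ o} g`. [cite: Shimura1971, §8.3 p. 237] -/
theorem heckePermElt_heckeIdxPre_spec [NeZero r] (g : Gamma0 1) (o : Option (ZMod r)) :
    (((heckePermElt hr g (heckeIdxPre hr g o) : Gamma0 1) : SL(2, ℤ)) : Matrix (Fin 2) (Fin 2) ℤ) * heckeRep r o =
      heckeRep r (heckeIdxPre hr g o).1 * ((g : SL(2, ℤ)) : Matrix (Fin 2) (Fin 2) ℤ) := by
  have h := heckePermElt_spec hr g (heckeIdxPre hr g o)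
  rwa [heckePerm_heckeIdxPre] at h

/-- **The `∞`-index is fixed by `σ_π` and `π'` there is `G_∞ T^{r w} G_∞⁻¹`** (`π = g T^w g⁻¹`, `G_∞ = g'_{σ_g⁻¹ ∞}`).
[cite: Shimura1971, §8.3 (8.3.2)] -/
theorem heckeData_conj_T_zpow_none [NeZero r] (g : Gamma0 1) (w : ℤ) (π : Gamma0 M)
    (hπ : (π : SL(2, ℤ)) = (g : SL(2, ℤ)) * T ^ w * (g : SL(2, ℤ))⁻¹) (i : HeckeIdx M r)
    (hi : i.1 = (heckeIdxPre hr g none).1) :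
    (heckePerm hr π i).1 = (heckeIdxPre hr g none).1 ∧
      ((heckePermElt hr π i : Gamma0 M) : SL(2, ℤ)) =
        ((heckePermElt hr g (heckeIdxPre hr g none) : Gamma0 1) : SL(2, ℤ)) * T ^ ((r : ℤ) * w) *
          (((heckePermElt hr g (heckeIdxPre hr g none) : Gamma0 1) : SL(2, ℤ)))⁻¹ := by
  set G : SL(2, ℤ) := ((heckePermElt hr g (heckeIdxPre hr g none) : Gamma0 1) : SL(2, ℤ)) with hG
  have hspec := heckePermElt_heckeIdxPre_spec hr g none
  rw [← hG] at hspec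
  refine heckePerm_eq_of_candidate hr π i _ (G * T ^ ((r : ℤ) * w) * G⁻¹) ?_
  have hβ : heckeRep r (heckeIdxPre hr g none).1 =
      (G : Matrix (Fin 2) (Fin 2) ℤ) * heckeRep r none * (((g : SL(2, ℤ))⁻¹ : SL(2, ℤ)) : Matrix (Fin 2) (Fin 2) ℤ) := by
    rw [hspec, Matrix.mul_assoc, coe_mul_coe_inv, Matrix.mul_one]
  rw [hi, hπ, coe_mul, coe_mul, coe_mul, coe_mul]
  conv_lhs => rw [hβ]
  simp only [← Matrix.mul_assoc]
  rw [Matrix.mul_assoc ((G : Matrix (Fin 2) (Fin 2) ℤ) * _) ((G⁻¹ : SL(2, ℤ)) : Matrix (Fin 2) (Fin 2) ℤ),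
    coe_inv_mul_coe, Matrix.mul_one, Matrix.mul_assoc (G : Matrix (Fin 2) (Fin 2) ℤ), ← heckeRep_none_mul_T_zpow,
    ← Matrix.mul_assoc, hspec]

/-- **`σ_π` moves the index over `j` to the index over `j' = j + w (mod r)`, with `π' = G_j T^q G_{j'}⁻¹`** (`q` the carry,
`G_j = g'_{σ_g⁻¹ j}`). [cite: Shimura1971, §8.3 (8.3.2)] -/
theorem heckeData_conj_T_zpow_some [NeZero r] (g : Gamma0 1) (w : ℤ) (π : Gamma0 M)
    (hπ : (π : SL(2, ℤ)) = (g : SL(2, ℤ)) * T ^ w * (g : SL(2, ℤ))⁻¹) (j j' : ZMod r) (q : ℤ)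
    (hq : q * r = (j.val : ℤ) + w - (j'.val : ℤ)) (i : HeckeIdx M r) (hi : i.1 = (heckeIdxPre hr g (some j)).1) :
    (heckePerm hr π i).1 = (heckeIdxPre hr g (some j')).1 ∧
      ((heckePermElt hr π i : Gamma0 M) : SL(2, ℤ)) =
        ((heckePermElt hr g (heckeIdxPre hr g (some j)) : Gamma0 1) : SL(2, ℤ)) * T ^ q *
          (((heckePermElt hr g (heckeIdxPre hr g (some j')) : Gamma0 1) : SL(2, ℤ)))⁻¹ := by
  set G : SL(2, ℤ) := ((heckePermElt hr g (heckeIdxPre hr g (some j)) : Gamma0 1) : SL(2, ℤ)) with hG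
  set G' : SL(2, ℤ) := ((heckePermElt hr g (heckeIdxPre hr g (some j')) : Gamma0 1) : SL(2, ℤ)) with hG'
  have hspec := heckePermElt_heckeIdxPre_spec hr g (some j)
  have hspec' := heckePermElt_heckeIdxPre_spec hr g (some j')
  rw [← hG] at hspec
  rw [← hG'] at hspec'
  refine heckePerm_eq_of_candidate hr π i _ (G * T ^ q * G'⁻¹) ?_
  have hβ : heckeRep r (heckeIdxPre hr g (some j')).1 =
      (G' : Matrix (Fin 2) (Fin 2) ℤ) * heckeRep r (some j') *
        (((g : SL(2, ℤ))⁻¹ : SL(2, ℤ)) : Matrix (Fin 2) (Fin 2) ℤ) := by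
    rw [hspec', Matrix.mul_assoc, coe_mul_coe_inv, Matrix.mul_one]
  rw [hi, hπ, coe_mul, coe_mul, coe_mul, coe_mul]
  conv_lhs => rw [hβ]
  simp only [← Matrix.mul_assoc]
  rw [Matrix.mul_assoc ((G : Matrix (Fin 2) (Fin 2) ℤ) * _) ((G'⁻¹ : SL(2, ℤ)) : Matrix (Fin 2) (Fin 2) ℤ),
    coe_inv_mul_coe, Matrix.mul_one, Matrix.mul_assoc (G : Matrix (Fin 2) (Fin 2) ℤ),
    ← heckeRep_some_mul_T_zpow j j' w q (by linarith [hq]), ← Matrix.mul_assoc, hspec]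

end HeckeData

/-! ### The restriction formula -/

section Restriction

variable {M r : ℕ} [NeZero r] (hr : r.Prime) {K : Type*} [CommRing K] {u : Gamma0 M → Fin 1 → K}

/-- **`(T_r u)(g T^w g⁻¹)` as a two-term sum** (`r` prime, `r ∤ M`, `r ∤ w`, `M ∣ c_g² w`): with the level-`1` Hecke data
`G_o = g'_{σ_g⁻¹ o}` of `g`,
`(T_r u)(g T^w g⁻¹) = u(G_∞ T^{r w} G_∞⁻¹) + u(G_0 T^{w} G_0⁻¹)` — the fixed index `σ_g⁻¹ ∞` of `σ_π` contributes the
first term, the single `r`-cycle through the indices `σ_g⁻¹ j` (`j ↦ j + w`) telescopes to the second.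
[cite: Shimura1971, §8.3 (8.3.2)] -/
theorem heckeU_apply_conj_T_zpow (hrM : ¬ r ∣ M) (hu : u ∈ cocycles 0 M K) (g : Gamma0 1) {w : ℤ}
    (hw : (M : ℤ) ∣ ((g : SL(2, ℤ)) 1 0) ^ 2 * w) (hrw : ¬ (r : ℤ) ∣ w) :
    ∃ (hinf : ((heckePermElt hr g (heckeIdxPre hr g none) : Gamma0 1) : SL(2, ℤ)) * T ^ ((r : ℤ) * w) *
        (((heckePermElt hr g (heckeIdxPre hr g none) : Gamma0 1) : SL(2, ℤ)))⁻¹ ∈ Gamma0 M)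
      (h₀ : ((heckePermElt hr g (heckeIdxPre hr g (some 0)) : Gamma0 1) : SL(2, ℤ)) * T ^ w *
        (((heckePermElt hr g (heckeIdxPre hr g (some 0)) : Gamma0 1) : SL(2, ℤ)))⁻¹ ∈ Gamma0 M),
      heckeU 0 M K hr u ⟨(g : SL(2, ℤ)) * T ^ w * (g : SL(2, ℤ))⁻¹, conj_T_zpow_mem_Gamma0 hw⟩ = u ⟨_, hinf⟩ + u ⟨_, h₀⟩ := by
  classical
  set π : Gamma0 M := ⟨(g : SL(2, ℤ)) * T ^ w * (g : SL(2, ℤ))⁻¹, conj_T_zpow_mem_Gamma0 hw⟩ with hπdef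
  have hπ : (π : SL(2, ℤ)) = (g : SL(2, ℤ)) * T ^ w * (g : SL(2, ℤ))⁻¹ := rfl
  -- abbreviations: level-`1` data of `g`
  let G : Option (ZMod r) → SL(2, ℤ) := fun o ↦ ((heckePermElt hr g (heckeIdxPre hr g o) : Gamma0 1) : SL(2, ℤ))
  -- the level-`M` indices, reindexed by `Option (ZMod r)` through `σ_g`
  let e : HeckeIdx M r ≃ HeckeIdx 1 r :=
    Equiv.subtypeEquivRight (fun o ↦ ⟨fun _ ↦ heckeIdx_one_cond hr o, fun _ _ ↦ hrM⟩)
  let J : Option (ZMod r) ≃ HeckeIdx M r :=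
    ((Equiv.subtypeUnivEquiv (fun o ↦ heckeIdx_one_cond hr o)).symm.trans (heckePermEquiv hr g).symm).trans e.symm
  have hJ : ∀ o, (J o).1 = (heckeIdxPre hr g o).1 := fun o ↦ rfl
  -- the `∞` term
  obtain ⟨-, hnone⟩ := heckeData_conj_T_zpow_none hr g w π hπ (J none) (hJ none)
  have hinf : G none * T ^ ((r : ℤ) * w) * (G none)⁻¹ ∈ Gamma0 M := by
    have h := (heckePermElt hr π (J none)).2
    rw [hnone] at h
    exact h
  -- the cycle: indices over `j_k = k w`, carries `q_k`
  let w' : ZMod r := (w : ZMod r)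
  have hw' : IsUnit w' := by
    haveI : Fact r.Prime := ⟨hr⟩
    rw [isUnit_iff_ne_zero]
    intro h0
    exact hrw ((ZMod.intCast_zmod_eq_zero_iff_dvd w r).mp h0)
  let jk : ℕ → ZMod r := fun k ↦ (k : ZMod r) * w'
  let q : ℕ → ℤ := fun k ↦ (((jk k).val : ℤ) + w - ((jk (k + 1)).val : ℤ)) / r
  have hjk : ∀ k, jk (k + 1) = jk k + w' := fun k ↦ by simp only [jk]; push_cast; ring
  have hq : ∀ k, q k * r = ((jk k).val : ℤ) + w - ((jk (k + 1)).val : ℤ) := by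
    intro k
    have h := carry_mul r (jk k) w
    rwa [← hjk k] at h
  have hdata : ∀ k, (heckePerm hr π (J (some (jk k)))).1 = (heckeIdxPre hr g (some (jk (k + 1)))).1 ∧
      ((heckePermElt hr π (J (some (jk k))) : Gamma0 M) : SL(2, ℤ)) = G (some (jk k)) * T ^ (q k) * (G (some (jk (k + 1))))⁻¹ :=
    fun k ↦ heckeData_conj_T_zpow_some hr g w π hπ (jk k) (jk (k + 1)) (q k) (hq k) (J (some (jk k))) (hJ _)
  have hE : ∀ k, G (some (jk k)) * T ^ (q k) * (G (some (jk (k + 1))))⁻¹ ∈ Gamma0 M := by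
    intro k
    have h := (heckePermElt hr π (J (some (jk k)))).2
    rw [(hdata k).2] at h
    exact h
  obtain ⟨hmemr, htel⟩ := cocycle_zero_telescope hu (fun k ↦ G (some (jk k))) q hE r
  -- after `r` steps the cycle closes: `j_r = j_0 = 0`, `Σ q_k = w`
  have hj0 : jk 0 = 0 := by simp [jk]
  have hjr : jk r = 0 := by simp [jk]
  have hsumq : ∑ k ∈ Finset.range r, q k = w := by
    have h1 : (∑ k ∈ Finset.range r, q k) * r = w * r := by
      rw [Finset.sum_mul, Finset.sum_congr rfl fun k _ ↦ hq k]
      have h2 : ∀ k ∈ Finset.range r, ((jk k).val : ℤ) + w - ((jk (k + 1)).val : ℤ) =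
          w - (((jk (k + 1)).val : ℤ) - ((jk k).val : ℤ)) := fun k _ ↦ by ring
      rw [Finset.sum_congr rfl h2, Finset.sum_sub_distrib, Finset.sum_range_sub (fun k ↦ ((jk k).val : ℤ)), hjr, hj0,
        sub_self, sub_zero, Finset.sum_const, Finset.card_range, nsmul_eq_mul, mul_comm]
    exact mul_right_cancel₀ (by exact_mod_cast hr.ne_zero) h1
  have h₀ : G (some 0) * T ^ w * (G (some 0))⁻¹ ∈ Gamma0 M := by
    have h := hmemr
    simp only [hj0, hjr, hsumq] at h
    exact h
  refine ⟨hinf, h₀, ?_⟩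
  -- expand the Hecke operator and reindex
  rw [heckeU_apply]
  simp only [act_zero_eq_id, LinearMap.id_apply]
  rw [← Fintype.sum_equiv J (fun o ↦ u (heckePermElt hr π (J o))) (fun i ↦ u (heckePermElt hr π i)) (fun o ↦ rfl),
    Fintype.sum_option]
  congr 1
  · -- the `∞` term
    congr 1
    exact Subtype.ext hnone
  · -- the cycle
    rw [sum_zmod_eq_sum_range_mul _ hw'.unit]
    have hterm : ∀ k ∈ Finset.range r, u (heckePermElt hr π (J (some ((k : ZMod r) * (hw'.unit : ZMod r))))) =
        u ⟨_, hE k⟩ := by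
      intro k _
      congr 1
      exact Subtype.ext (hdata k).2
    rw [Finset.sum_congr rfl hterm, ← htel]
    congr 1
    apply Subtype.ext
    show G (some (jk 0)) * T ^ (∑ k ∈ Finset.range r, q k) * (G (some (jk r)))⁻¹ = G (some 0) * T ^ w * (G (some 0))⁻¹
    rw [hj0, hjr, hsumq]

end Restriction

/-! ### The restriction formula on cusp values: `(T_r u)(π_x) = r · u(π_{ρ_r x}) + u(π_{ρ_r⁻¹ x})` -/

section CuspValueHecke

variable (M : ℕ) [NeZero M] {r : ℕ} [NeZero r] (hr : r.Prime) {K : Type*} [CommRing K] {u : Gamma0 M → Fin 1 → K}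

omit [NeZero M] in
/-- Equal squares give equal widths (plumbing). [folklore] -/
theorem width_eq_of_sq_eq {c c' : ℤ} (h : c ^ 2 = c' ^ 2) :
    M / Nat.gcd M (c.natAbs ^ 2) = M / Nat.gcd M (c'.natAbs ^ 2) := by
  have h' : c.natAbs ^ 2 = c'.natAbs ^ 2 := by
    rw [← Int.natAbs_pow, ← Int.natAbs_pow, h]
  rw [h']

/-- **The neighbours `ρ_r x`, `ρ_r⁻¹ x` have the width of `x`** (their denominators are `c`, `c/r` or `rc` up to sign, `r`
prime to `M`). [cite: Shimura1971, §1.6] -/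
theorem width_heckeNbr (hrM : ¬ r ∣ M) (x : OnePoint ℚ) :
    M / Nat.gcd M (((cuspMatrix (heckeNbrInfty hr x)) 1 0).natAbs ^ 2) = M / Nat.gcd M (((cuspMatrix x) 1 0).natAbs ^ 2) ∧
      M / Nat.gcd M (((cuspMatrix (heckeNbrZero hr x)) 1 0).natAbs ^ 2) = M / Nat.gcd M (((cuspMatrix x) 1 0).natAbs ^ 2) := by
  have hcop : IsCoprime (r : ℤ) (M : ℤ) := Nat.isCoprime_iff_coprime.mpr ((Nat.Prime.coprime_iff_not_dvd hr).mpr hrM)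
  have hr0 : (r : ℤ) ≠ 0 := by exact_mod_cast hr.ne_zero
  set g : Gamma0 1 := cuspMatrix₁ x with hg
  set Ginf : SL(2, ℤ) := ((heckePermElt hr g (heckeIdxPre hr g none) : Gamma0 1) : SL(2, ℤ)) with hGinf
  set G₀ : SL(2, ℤ) := ((heckePermElt hr g (heckeIdxPre hr g (some 0)) : Gamma0 1) : SL(2, ℤ)) with hG₀
  -- squares of denominators from the defining matrices of the neighbours
  have hsq_inf : ((cuspMatrix (heckeNbrInfty hr x)) 1 0) ^ 2 = (Ginf 1 0) ^ 2 :=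
    (conj_T_zpow_eq_of_smul_infty_eq (cuspMatrix (heckeNbrInfty hr x)) Ginf
      (by rw [cuspMatrix_smul_infty, heckeNbrInfty_def]) 0).2
  have hsq_zero : ((cuspMatrix (heckeNbrZero hr x)) 1 0) ^ 2 = (G₀ 1 0) ^ 2 :=
    (conj_T_zpow_eq_of_smul_infty_eq (cuspMatrix (heckeNbrZero hr x)) G₀
      (by rw [cuspMatrix_smul_infty, heckeNbrZero_def]) 0).2
  rw [width_eq_of_sq_eq M hsq_inf, width_eq_of_sq_eq M hsq_zero]
  -- bottom-left entries of the level-`1` data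
  have hs_inf := heckePermElt_heckeIdxPre_spec hr g none
  have hs_zero := heckePermElt_heckeIdxPre_spec hr g (some 0)
  rw [← hGinf] at hs_inf
  rw [← hG₀] at hs_zero
  have hc : ((g : SL(2, ℤ)) : Matrix (Fin 2) (Fin 2) ℤ) 1 0 = (cuspMatrix x) 1 0 := by rw [hg, coe_cuspMatrix₁]
  have e_inf : Ginf 1 0 * r = (heckeRep r (heckeIdxPre hr g none).1 * ((g : SL(2, ℤ)) : Matrix (Fin 2) (Fin 2) ℤ)) 1 0 := by
    rw [← (mul_heckeRep_none_apply_one (Ginf : Matrix (Fin 2) (Fin 2) ℤ)).1, hs_inf]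
  have e_zero : G₀ 1 0 = (heckeRep r (heckeIdxPre hr g (some 0)).1 * ((g : SL(2, ℤ)) : Matrix (Fin 2) (Fin 2) ℤ)) 1 0 := by
    rw [← (mul_heckeRep_some_apply_one (G₀ : Matrix (Fin 2) (Fin 2) ℤ) (0 : ZMod r)).1, hs_zero]
  constructor
  · rcases ho : (heckeIdxPre hr g none).1 with _ | j
    · rw [ho, (heckeRep_none_mul_apply_one _).1, hc] at e_inf
      rw [← e_inf, mul_comm, width_mul_eq_of_isCoprime M hcop]
    · rw [ho, (heckeRep_some_mul_apply_one _ j).1, hc, mul_comm] at e_inf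
      rw [mul_left_cancel₀ hr0 e_inf]
  · rcases ho : (heckeIdxPre hr g (some 0)).1 with _ | j
    · rw [ho, (heckeRep_none_mul_apply_one _).1, hc] at e_zero
      rw [e_zero]
    · rw [ho, (heckeRep_some_mul_apply_one _ j).1, hc] at e_zero
      rw [e_zero, width_mul_eq_of_isCoprime M hcop]

/-- **PARABOLICITY, restriction formula.**  For an additive `u : Γ₀(M) → K`, a prime `r ∤ M` and a cusp `x`:
`(T_r u)(π_x) = r · u(π_{ρ_r x}) + u(π_{ρ_r⁻¹ x})`, where `π_y = g_y T^{w_y} g_y⁻¹` is the normalised generator of the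
stabiliser of `y` in `Γ₀(M)` (`g_y = cuspMatrix y`, `w_y` the width) and `ρ_r^{±1}` are p2's neighbour maps
`heckeNbrInfty` / `heckeNbrZero`.  (Degree-`1` companion of p2's `cuspFunHecke_eq_heckeNbr`, with the weights of `ρ_r` and
`ρ_r⁻¹` exchanged.) [cite: Shimura1971, §8.3 (8.3.2)] -/
theorem heckeU_cuspValue (hrM : ¬ r ∣ M) (hu : u ∈ cocycles 0 M K) (x : OnePoint ℚ) :
    heckeU 0 M K hr u ⟨cuspMatrix x * T ^ ((M / Nat.gcd M (((cuspMatrix x) 1 0).natAbs ^ 2) : ℕ) : ℤ) * (cuspMatrix x)⁻¹,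
        conj_T_zpow_mem_Gamma0 (dvd_sq_mul_width M _)⟩ =
      (r : ℤ) • u ⟨cuspMatrix (heckeNbrInfty hr x) *
          T ^ ((M / Nat.gcd M (((cuspMatrix (heckeNbrInfty hr x)) 1 0).natAbs ^ 2) : ℕ) : ℤ) *
          (cuspMatrix (heckeNbrInfty hr x))⁻¹, conj_T_zpow_mem_Gamma0 (dvd_sq_mul_width M _)⟩ +
        u ⟨cuspMatrix (heckeNbrZero hr x) *
          T ^ ((M / Nat.gcd M (((cuspMatrix (heckeNbrZero hr x)) 1 0).natAbs ^ 2) : ℕ) : ℤ) *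
          (cuspMatrix (heckeNbrZero hr x))⁻¹, conj_T_zpow_mem_Gamma0 (dvd_sq_mul_width M _)⟩ := by
  set w : ℤ := ((M / Nat.gcd M (((cuspMatrix x) 1 0).natAbs ^ 2) : ℕ) : ℤ) with hwdef
  have hw : (M : ℤ) ∣ (((cuspMatrix₁ x : Gamma0 1) : SL(2, ℤ)) 1 0) ^ 2 * w := dvd_sq_mul_width M _
  have hrw : ¬ (r : ℤ) ∣ w := by
    intro h
    apply hrM
    have h1 : (M / Nat.gcd M (((cuspMatrix x) 1 0).natAbs ^ 2)) ∣ M := Nat.div_dvd_of_dvd (Nat.gcd_dvd_left _ _)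
    exact (Int.natCast_dvd_natCast.mp h).trans h1
  set Ginf : SL(2, ℤ) := ((heckePermElt hr (cuspMatrix₁ x) (heckeIdxPre hr (cuspMatrix₁ x) none) : Gamma0 1) : SL(2, ℤ))
    with hGinf
  set G₀ : SL(2, ℤ) := ((heckePermElt hr (cuspMatrix₁ x) (heckeIdxPre hr (cuspMatrix₁ x) (some 0)) : Gamma0 1) : SL(2, ℤ))
    with hG₀
  obtain ⟨hinf, h0, hformula⟩ := heckeU_apply_conj_T_zpow hr hrM hu (cuspMatrix₁ x) hw hrw
  obtain ⟨hWinf, hWzero⟩ := width_heckeNbr M hr hrM x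
  have e0 : (⟨cuspMatrix x * T ^ w * (cuspMatrix x)⁻¹, conj_T_zpow_mem_Gamma0 (dvd_sq_mul_width M _)⟩ : Gamma0 M) =
      ⟨((cuspMatrix₁ x : Gamma0 1) : SL(2, ℤ)) * T ^ w * (((cuspMatrix₁ x : Gamma0 1) : SL(2, ℤ)))⁻¹,
        conj_T_zpow_mem_Gamma0 hw⟩ := rfl
  rw [e0, hformula]
  congr 1
  · -- the `∞` term: exponent `r w = r w_{ρ_r x}`
    have hinf' : Ginf * T ^ ((r : ℤ) * ((M / Nat.gcd M (((cuspMatrix (heckeNbrInfty hr x)) 1 0).natAbs ^ 2) : ℕ) : ℤ)) *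
        Ginf⁻¹ ∈ Gamma0 M := by rw [hWinf]; exact hinf
    have e1 : (⟨_, hinf⟩ : Gamma0 M) = ⟨_, hinf'⟩ :=
      Subtype.ext (congrArg (fun n : ℕ ↦ Ginf * T ^ ((r : ℤ) * (n : ℤ)) * Ginf⁻¹) hWinf.symm)
    rw [e1]
    exact apply_conj_T_zpow_eq_zsmul M hu (heckeNbrInfty hr x) _ (heckeNbrInfty_def hr x).symm (r : ℤ) hinf'
  · -- the cycle term: exponent `w = 1 · w_{ρ_r⁻¹ x}`
    have h0' : G₀ * T ^ ((1 : ℤ) * ((M / Nat.gcd M (((cuspMatrix (heckeNbrZero hr x)) 1 0).natAbs ^ 2) : ℕ) : ℤ)) *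
        G₀⁻¹ ∈ Gamma0 M := by rw [one_mul, hWzero]; exact h0
    have e2 : (⟨_, h0⟩ : Gamma0 M) = ⟨_, h0'⟩ :=
      Subtype.ext (by
        show G₀ * T ^ w * G₀⁻¹ = G₀ * T ^ ((1 : ℤ) * _) * G₀⁻¹
        rw [one_mul]
        exact congrArg (fun n : ℕ ↦ G₀ * T ^ (n : ℤ) * G₀⁻¹) hWzero.symm)
    rw [e2, apply_conj_T_zpow_eq_zsmul M hu (heckeNbrZero hr x) _ (heckeNbrZero_def hr x).symm (1 : ℤ) h0', one_smul]

end CuspValueHecke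

end Summit.BirchSwinnertonDyer.BirchSwinnertonDyer.Theorems.ManinLocalTwoThree
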